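import Mathlib.Analysis.InnerProductSpace.Adjoint
import Mathlib.Analysis.InnerProductSpace.Rayleigh
import Mathlib.Analysis.Normed.Algebra.Exponential
import Mathlib.Analysis.SpecialFunctions.Pow.Real
import HarnessLib

/-!
# Obscured symmetry breaking and low-lying states (Koma–Tasaki 1994; trunk T-QLATTICE)

Fact item `wi-03676` (route HubbardSuperconductivity/WeakCouplingBCS). Vendors, as named facts
`def … : Prop`, the finite-volume theorems of

* T. Koma, H. Tasaki, *Symmetry breaking and finite-size effects in quantum many-body systems*,
  J. Stat. Phys. **76** (1994) 745–803, arXiv:cond-mat/9708132 (`KomaTasaki1994`), §2.2–2.4: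
  Theorem 2.2 (Horsch–von der Linden: LRO in an eigenstate with vanishing order parameter gives
  a "low-lying" state `O_Λ Φ / ‖O_Λ Φ‖` with excitation energy `≤ c₀/N`, `c₀ = 2 r² h μ⁻²`),
  Theorem 2.3 (`U(1)` symmetry: the states `Ψ^{(M)} = (O^±)^{|M|} Φ / ‖…‖` are well defined and
  `|⟨Ψ^{(M)}, H Ψ^{(M)}⟩ - E| ≤ c₁ |M|` for `N ≥ (4r/μ)²`, `|M|/N ≤ μ²/(8r)`), Theorem 2.4
  (with the extra `SU(2)`-type relation `[O¹, O²] = iγC` and the `π`-rotation symmetry: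
  `|⟨Ψ^{(M)}, H Ψ^{(M)}⟩ - E| ≤ c₃ M²/N` for `M²/N ≤ c₂`, the "Anderson tower"), and the exact
  finite-volume identity (2.29) of Theorem 2.5 (`⟨Ξ^{(k)}, O² Ξ^{(k)}⟩ = 0` for the
  symmetry-breaking trial states `Ξ^{(k)}`).

Theorem 2.2 is PROVED in this file (both parts: `horschVonDerLinden_holds`,
`horschVonDerLinden_eigenstate_holds`), and so is the identity (2.29) of Theorem 2.5
(`theorem_2_5_orderTwo_holds`, final section); Theorems 2.3 and 2.4 remain named facts.

Direction of these results: long-range order WITHOUT explicit symmetry breaking in finite volume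
("obscured symmetry breaking", KT (2.17)–(2.18)) ⟹ low-lying states ⟹ infinite-volume ground
states WITH explicit symmetry breaking and order parameter `m ≥ √2 o μ` (`√3` for `SU(2)`;
KT Theorem 2.5 (2.30), Theorem 2.8, Corollary 2.9). The infinite-volume half (Thm. 2.5 (2.30),
Thm. 2.8, Cor. 2.9: limits `Λ ↑ ℤ^d` along subsequences, then `k ↑ ∞`) is **not** vendored here
(it needs the infinite-volume state framework of `InfiniteVolumeStates.lean` specialised to
translation-invariant local Hamiltonians and order operators; a separate item). The converse
direction (symmetry breaking under an infinitesimal field ⟹ LRO of every finite-volume ground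
state) is not a Koma–Tasaki theorem.

## Setting (KT §2.1–2.3, abstract)

A finite lattice `Λ` (`Fintype`, `N = |Λ|`), a finite-dimensional complex Hilbert space `E`
(KT: `⊗_x 𝓗_x`; the tensor structure is not used by Theorems 2.2–2.4, only commutators, norms
and supports), bounded operators `E →L[ℂ] E` with the operator norm, local Hamiltonians `h_x`
(`H_Λ = Σ_x h_x`, (2.3)), order-operator densities `o^{(α)}_x` (`O^{(α)}_Λ = Σ_x o^{(α)}_x`,
(2.5)/(2.13)), support sets `S_x` with `|S_x| ≤ r`, and norm bounds `‖h_x‖ ≤ h`, `‖o_x‖ ≤ o`.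
States are unit vectors; `⟨Φ, A Φ⟩` is Mathlib's inner product `⟪Φ, A Φ⟫_ℂ`.

## Mathlib search

Mathlib has `ContinuousLinearMap` (ring structure, operator norm, `IsSelfAdjoint`, `adjoint`),
`NormedSpace.exp`, inner products; nothing on order operators, low-lying states or symmetry
breaking (`lean search` for `lowLying`, `orderOperator`, `SymmetryBreaking`, `KomaTasaki` in
Mathlib: no hits). The tree's `HubbardHubbardModel.lean` §KomaTasaki is the unrelated 1992 PRL
(decay of correlations in `d ≤ 2`); `DWaveSource.lean` uses KT §1's order parameter with a
source field.

## Design notes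

* "A constant which depends only on `h, r, μ`" (KT Thm. 2.3; `h, o, r, μ, γ` in Thm. 2.4) is
  rendered as `∃ c : ℝ → ℕ → ℝ → ℝ, ∀ (all systems and states) …`, the constant being chosen
  before the lattice, the Hilbert space and the operators (universe-polymorphic in `Λ`, `E`).
* `(O^+)^M` for negative `M` means `(O^-)^{-M}` (KT after (2.19)); `orderPow`.
* Hypothesis (vi) of Thm. 2.4, `U H U⁻¹ = H`, `U Φ ∝ Φ` with `U = exp[i (π/√γ) O¹]`, is written
  `U * H = H * U` and `∃ c, U Φ = c • Φ` with Mathlib's `NormedSpace.exp`; we take `γ > 0`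
  (KT: "a real constant"; `√γ` and `γ^{-1/2} O` require `γ > 0`).
* Energies `⟨Ψ, H Ψ⟩` are real for self-adjoint `H`; the facts bound `|re ⟪Ψ, H Ψ⟫ - E|`.
* The ground-state clause of Thm. 2.2 uses the variational characterisation
  `∀ ψ, ‖ψ‖ = 1 → E ≤ re ⟪ψ, H ψ⟫` as hypothesis and produces an eigenvector orthogonal to `Φ`.
* **Tacit non-degeneracy (review of p3355).** KT tacitly use `o > 0` and `N ≥ 1`: with
  `o = 0` (or `Λ = ∅`) the all-zero system satisfies i)–iv) ((2.17) reads `0 ≤ 0`) while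
  `O^+ Φ = 0`, refuting Theorems 2.2–2.4 as literally transcribed. Hence `U1System` carries the
  field `obar_pos : 0 < o`, the Horsch–von der Linden facts take `0 < o` and `[Nonempty Λ]`, and the
  size conditions (2.21), (2.24) are written multiplied out (`|M| ≤ (μ²/8r) N`, `M² ≤ c₂ N`) so
  that Lean's junk value `x / 0 = 0` cannot admit the empty lattice.  With these, (2.17) gives
  `‖O^{(1)} Φ‖ ≥ μ o N > 0` (`IsLROEigenstate.order_zero_apply_ne_zero`, proved).
-/

noncomputable section

open Complex Finset
open scoped InnerProductSpace ComplexConjugate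

namespace Literature.MathematicalPhysics.QuantumLattice.KomaTasaki

universe u v

variable {Λ : Type u} [Fintype Λ] {E : Type v} [NormedAddCommGroup E] [InnerProductSpace ℂ E]

/-! ### The abstract `U(1)`-symmetric system (KT §2.3, hypotheses (2.12)–(2.14), i)–iii)) -/

/-- **A Koma–Tasaki `U(1)` system** on the finite lattice `Λ` with Hilbert space `E`
(KT §2.3): local Hamiltonians `h_x` (`H_Λ = Σ h_x`), two order-operator densities
`o^{(1)}_x, o^{(2)}_x` (indexed by `Fin 2`), the self-adjoint `U(1)` generator `C_Λ` with
`[H_Λ, C_Λ] = 0` (2.12) and `[O^{(1)}, C] = -i O^{(2)}`, `[O^{(2)}, C] = i O^{(1)}` (2.14), and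
hypotheses i) `[o^{(α)}_x, o^{(β)}_y] = 0` for `x ≠ y`; ii) `[h_x, o^{(α)}_y] = 0` unless
`y ∈ S_x`, `|S_x| ≤ r`, `r ≥ 2`; iii) `‖h_x‖ ≤ h`, `‖o^{(α)}_x‖ ≤ o`.
[cite: KomaTasaki1994, §2.3 (2.12)–(2.17) i)–iii)] -/
structure U1System (Λ : Type u) [Fintype Λ] (E : Type v) [NormedAddCommGroup E]
    [InnerProductSpace ℂ E] where
  /-- local Hamiltonians `h_x` -/
  h : Λ → E →L[ℂ] E
  /-- order-operator densities `o^{(α)}_x`, `α ∈ {0, 1}` for KT's `α ∈ {1, 2}` -/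
  o : Fin 2 → Λ → E →L[ℂ] E
  /-- the `U(1)` generator `C_Λ` -/
  C : E →L[ℂ] E
  /-- support sets `S_x` -/
  supp : Λ → Finset Λ
  /-- the range bound `r` -/
  r : ℕ
  /-- the norm bound `h` on the `h_x` -/
  hbar : ℝ
  /-- the norm bound `o` on the `o_x` -/
  obar : ℝ
  /-- `h_x` self-adjoint (as symmetry of the underlying linear map; no completeness needed) -/
  isSymmetric_h : ∀ x, (h x : E →ₗ[ℂ] E).IsSymmetric
  isSymmetric_o : ∀ α x, (o α x : E →ₗ[ℂ] E).IsSymmetric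
  isSymmetric_C : (C : E →ₗ[ℂ] E).IsSymmetric
  /-- (2.12) `[H_Λ, C_Λ] = 0` -/
  commute_hamiltonian_C : Commute (∑ x, h x) C
  /-- (2.14) `[O^{(1)}, C] = -i O^{(2)}` -/
  order_zero_C : (∑ x, o 0 x) * C - C * (∑ x, o 0 x) = -(I • ∑ x, o 1 x)
  /-- (2.14) `[O^{(2)}, C] = i O^{(1)}` -/
  order_one_C : (∑ x, o 1 x) * C - C * (∑ x, o 1 x) = I • ∑ x, o 0 x
  /-- i) -/
  commute_o : ∀ x y, x ≠ y → ∀ α β, Commute (o α x) (o β y)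
  /-- ii) -/
  commute_h_o : ∀ x y, y ∉ supp x → ∀ α, Commute (h x) (o α y)
  /-- ii) -/
  card_supp_le : ∀ x, (supp x).card ≤ r
  /-- ii) -/
  two_le_r : 2 ≤ r
  /-- iii) -/
  norm_h_le : ∀ x, ‖h x‖ ≤ hbar
  /-- iii) -/
  norm_o_le : ∀ α x, ‖o α x‖ ≤ obar
  /-- `o > 0` (tacit in KT: with (2.17) it is what makes `‖O Φ‖ ≠ 0`, p. 13 "`Ψ` is well defined
  because of (2.7)"; without it the all-zero system satisfies i)–iv) and refutes Theorems 2.2–2.4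
  as stated). -/
  obar_pos : 0 < obar

namespace U1System

variable (sys : U1System Λ E)

/-- The Hamiltonian `H_Λ = Σ_x h_x` (KT (2.3)). [cite: KomaTasaki1994, (2.3)] -/
def hamiltonian : E →L[ℂ] E := ∑ x, sys.h x

/-- The order operators `O^{(α)}_Λ = Σ_x o^{(α)}_x` (KT (2.13)). [cite: KomaTasaki1994, (2.13)] -/
def order (α : Fin 2) : E →L[ℂ] E := ∑ x, sys.o α x

/-- The raising operator `O^+ = O^{(1)} + i O^{(2)}` (KT (2.15)). [cite: KomaTasaki1994, (2.15)] -/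
def orderPlus : E →L[ℂ] E := sys.order 0 + I • sys.order 1

/-- The lowering operator `O^- = O^{(1)} - i O^{(2)}` (KT (2.15)). [cite: KomaTasaki1994, (2.15)] -/
def orderMinus : E →L[ℂ] E := sys.order 0 - I • sys.order 1

/-- `(O^+)^M`, with the convention `(O^+)^M = (O^-)^{-M}` for negative `M` (KT after (2.19)).
[cite: KomaTasaki1994, (2.19)] -/
def orderPow (M : ℤ) : E →L[ℂ] E :=
  if 0 ≤ M then sys.orderPlus ^ M.toNat else sys.orderMinus ^ (-M).toNat

/-- The trial state `Ψ^{(M)} = (O^+)^M Φ / ‖(O^+)^M Φ‖` (KT (2.19); junk `0` if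
`(O^+)^M Φ = 0`, excluded by Theorems 2.3–2.4). [cite: KomaTasaki1994, (2.19)] -/
def trialState (M : ℤ) (Φ : E) : E :=
  (‖sys.orderPow M Φ‖⁻¹ : ℂ) • sys.orderPow M Φ

/-- The symmetry-breaking trial state
`Ξ^{(k)} = (2k+1)^{-1/2} (Φ + Σ_{M=1}^k (Ψ^{(M)} + Ψ^{(-M)}))` (KT (2.27)).
[cite: KomaTasaki1994, (2.27)] -/
def xiState (k : ℕ) (Φ : E) : E :=
  ((Real.sqrt (2 * k + 1))⁻¹ : ℂ) •
    (Φ + ∑ M ∈ Finset.Icc 1 k, (sys.trialState M Φ + sys.trialState (-(M : ℤ)) Φ))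

/-- The Hamiltonian is self-adjoint (symmetric). [cite: KomaTasaki1994, §2.1] -/
theorem isSymmetric_hamiltonian : (sys.hamiltonian : E →ₗ[ℂ] E).IsSymmetric := by
  intro φ ψ
  simp only [hamiltonian, ContinuousLinearMap.toLinearMap_sum, LinearMap.coe_sum,
    ContinuousLinearMap.coe_coe, Finset.sum_apply, sum_inner, inner_sum]
  exact Finset.sum_congr rfl fun x _ => sys.isSymmetric_h x φ ψ

/-- The order operators are self-adjoint (symmetric). [cite: KomaTasaki1994, §2.3] -/
theorem isSymmetric_order (α : Fin 2) : (sys.order α : E →ₗ[ℂ] E).IsSymmetric := by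
  intro φ ψ
  simp only [order, ContinuousLinearMap.toLinearMap_sum, LinearMap.coe_sum,
    ContinuousLinearMap.coe_coe, Finset.sum_apply, sum_inner, inner_sum]
  exact Finset.sum_congr rfl fun x _ => sys.isSymmetric_o α x φ ψ

/-- Energies are real: `⟪ψ, H ψ⟫ = conj ⟪ψ, H ψ⟫`. [cite: KomaTasaki1994, §2.1] -/
theorem conj_inner_hamiltonian (ψ : E) :
    conj ⟪ψ, sys.hamiltonian ψ⟫_ℂ = ⟪ψ, sys.hamiltonian ψ⟫_ℂ := by
  rw [inner_conj_symm]
  exact sys.isSymmetric_hamiltonian ψ ψ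

/-- `[H_Λ, C_Λ] = 0`, restated for `hamiltonian`. [cite: KomaTasaki1994, (2.12)] -/
theorem commute_hamiltonian : Commute sys.hamiltonian sys.C := sys.commute_hamiltonian_C

/-- (2.16): `[O^+, C] = -O^+`. [cite: KomaTasaki1994, (2.16)] -/
theorem orderPlus_commutator : sys.orderPlus * sys.C - sys.C * sys.orderPlus = -sys.orderPlus := by
  have h0 := sys.order_zero_C
  have h1 := sys.order_one_C
  simp only [orderPlus, order, add_mul, mul_add, smul_mul_assoc, mul_smul_comm]
  have : (∑ x, sys.o 0 x) * sys.C + I • ((∑ x, sys.o 1 x) * sys.C) -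
      (sys.C * ∑ x, sys.o 0 x + I • (sys.C * ∑ x, sys.o 1 x)) =
      ((∑ x, sys.o 0 x) * sys.C - sys.C * ∑ x, sys.o 0 x) +
        I • ((∑ x, sys.o 1 x) * sys.C - sys.C * ∑ x, sys.o 1 x) := by
    rw [smul_sub]; abel
  rw [this, h0, h1, smul_smul, I_mul_I, neg_smul, one_smul, neg_add]
  abel

/-- (2.16): `[O^-, C] = O^-`. [cite: KomaTasaki1994, (2.16)] -/
theorem orderMinus_commutator :
    sys.orderMinus * sys.C - sys.C * sys.orderMinus = sys.orderMinus := by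
  have h0 := sys.order_zero_C
  have h1 := sys.order_one_C
  simp only [orderMinus, order, sub_mul, mul_sub, smul_mul_assoc, mul_smul_comm]
  have : (∑ x, sys.o 0 x) * sys.C - I • ((∑ x, sys.o 1 x) * sys.C) -
      (sys.C * ∑ x, sys.o 0 x - I • (sys.C * ∑ x, sys.o 1 x)) =
      ((∑ x, sys.o 0 x) * sys.C - sys.C * ∑ x, sys.o 0 x) -
        I • ((∑ x, sys.o 1 x) * sys.C - sys.C * ∑ x, sys.o 1 x) := by
    rw [smul_sub]; abel
  rw [this, h0, h1, smul_smul, I_mul_I, neg_smul, one_smul, sub_neg_eq_add]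
  abel

/-- `orderPow` at a nonnegative exponent. [cite: KomaTasaki1994, (2.19)] -/
theorem orderPow_of_nonneg {M : ℤ} (hM : 0 ≤ M) : sys.orderPow M = sys.orderPlus ^ M.toNat := by
  simp [orderPow, hM]

/-- `orderPow` at a negative exponent is a power of `O^-`. [cite: KomaTasaki1994, (2.19)] -/
theorem orderPow_of_neg {M : ℤ} (hM : M < 0) : sys.orderPow M = sys.orderMinus ^ (-M).toNat := by
  simp [orderPow, not_le.mpr hM]

/-- `orderPow 1 = O^+`. [cite: KomaTasaki1994, (2.19)] -/
@[simp] theorem orderPow_one : sys.orderPow 1 = sys.orderPlus := by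
  simp [orderPow]

/-- `orderPow (-1) = O^-`. [cite: KomaTasaki1994, (2.19)] -/
@[simp] theorem orderPow_neg_one : sys.orderPow (-1) = sys.orderMinus := by
  simp [orderPow]

end U1System

/-! ### The state: an eigenstate with obscured symmetry breaking (KT (2.17)–(2.18), iv)) -/

/-- **Hypothesis iv) and the standing assumptions on `Φ`** (KT §2.3): `Φ` is a normalised
simultaneous eigenvector of `H_Λ` (eigenvalue `E`) and of `C_Λ`, with long-range order
`⟨Φ, (O^{(1)})² Φ⟩ = ⟨Φ, (O^{(2)})² Φ⟩ ≥ (μ o N)²`, `0 < μ ≤ 1` (2.17). (Then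
`⟨Φ, O^{(α)} Φ⟩ = 0` automatically, (2.18): "obscured symmetry breaking".)
[cite: KomaTasaki1994, §2.3 iv) (2.17)] -/
structure IsLROEigenstate (sys : U1System Λ E) (Φ : E) (EΛ μ : ℝ) : Prop where
  norm_eq_one : ‖Φ‖ = 1
  eigen_hamiltonian : sys.hamiltonian Φ = (EΛ : ℂ) • Φ
  eigen_C : ∃ c : ℂ, sys.C Φ = c • Φ
  mu_pos : 0 < μ
  mu_le_one : μ ≤ 1
  lro : (μ * sys.obar * Fintype.card Λ) ^ 2 ≤ (⟪Φ, sys.order 0 (sys.order 0 Φ)⟫_ℂ).re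
  lro_eq : ⟪Φ, sys.order 0 (sys.order 0 Φ)⟫_ℂ = ⟪Φ, sys.order 1 (sys.order 1 Φ)⟫_ℂ

/-! ### Theorem 2.2 (Horsch–von der Linden) -/

/-- **KT Theorem 2.2 (Horsch–von der Linden), first part.** One order operator `O_Λ = Σ o_x`
with self-adjoint `o_x`, `‖h_x‖ ≤ h`, `‖o_x‖ ≤ o`, `[o_x, o_y] = 0` for all `x, y`,
`[h_x, o_y] = 0` unless `y ∈ S_x`, `|S_x| ≤ r`; `Φ` a normalised eigenvector of `H_Λ = Σ h_x`
with eigenvalue `E`, `⟨Φ, O Φ⟩ = 0` (2.6) and `⟨Φ, O² Φ⟩ ≥ (μ o N)²`, `0 < μ ≤ 1` (2.7), with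
`o > 0` and `N ≥ 1` (tacit in KT; they make `‖O Φ‖ ≥ μ o N > 0`). Then
`Ψ = O Φ / ‖O Φ‖` is well defined and `|⟨Ψ, H Ψ⟩ - E| ≤ c₀ / N` with `c₀ = 2 r² h μ⁻²` (2.9)
(the double-commutator identity `⟨Ψ, HΨ⟩ - E = ⟨Φ, [[O, H], O] Φ⟩ / (2 ‖OΦ‖²)`).
[cite: KomaTasaki1994, Theorem 2.2 (2.9)] -/
def horschVonDerLinden : Prop :=
  ∀ {Λ : Type u} [Fintype Λ] [Nonempty Λ] {E : Type v} [NormedAddCommGroup E]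
    [InnerProductSpace ℂ E] [FiniteDimensional ℂ E]
    (h o : Λ → E →L[ℂ] E) (supp : Λ → Finset Λ) (r : ℕ) (hbar obar μ : ℝ) (Φ : E) (EΛ : ℝ),
    (∀ x, (h x : E →ₗ[ℂ] E).IsSymmetric) → (∀ x, (o x : E →ₗ[ℂ] E).IsSymmetric) →
    (∀ x, ‖h x‖ ≤ hbar) → (∀ x, ‖o x‖ ≤ obar) → 0 < obar →
    (∀ x y, Commute (o x) (o y)) → (∀ x y, y ∉ supp x → Commute (h x) (o y)) →
    (∀ x, (supp x).card ≤ r) →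
    ‖Φ‖ = 1 → (∑ x, h x) Φ = (EΛ : ℂ) • Φ →
    ⟪Φ, (∑ x, o x) Φ⟫_ℂ = 0 → 0 < μ → μ ≤ 1 →
    (μ * obar * Fintype.card Λ) ^ 2 ≤ (⟪Φ, (∑ x, o x) ((∑ x, o x) Φ)⟫_ℂ).re →
      (∑ x, o x) Φ ≠ 0 ∧
      |(⟪(‖(∑ x, o x) Φ‖⁻¹ : ℂ) • (∑ x, o x) Φ,
          (∑ x, h x) ((‖(∑ x, o x) Φ‖⁻¹ : ℂ) • (∑ x, o x) Φ)⟫_ℂ).re - EΛ| ≤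
        (2 * (r : ℝ) ^ 2 * hbar / μ ^ 2) / Fintype.card Λ

/-- **KT Theorem 2.2, second part.** If moreover `Φ` is a ground state of `H_Λ`
(`E = min ⟨ψ, Hψ⟩`), then, `Ψ` being orthogonal to `Φ` by (2.6), the variational principle
gives an eigenvector `Φ^{(1)} ⊥ Φ` of `H_Λ` with eigenvalue `E^{(1)} ≤ E + c₀/N` (2.10): a
"low-lying eigenstate" (again with the tacit `o > 0`, `N ≥ 1`). [cite: KomaTasaki1994, Theorem 2.2 (2.10)] -/
def horschVonDerLinden_eigenstate : Prop :=
  ∀ {Λ : Type u} [Fintype Λ] [Nonempty Λ] {E : Type v} [NormedAddCommGroup E]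
    [InnerProductSpace ℂ E] [FiniteDimensional ℂ E]
    (h o : Λ → E →L[ℂ] E) (supp : Λ → Finset Λ) (r : ℕ) (hbar obar μ : ℝ) (Φ : E) (EΛ : ℝ),
    (∀ x, (h x : E →ₗ[ℂ] E).IsSymmetric) → (∀ x, (o x : E →ₗ[ℂ] E).IsSymmetric) →
    (∀ x, ‖h x‖ ≤ hbar) → (∀ x, ‖o x‖ ≤ obar) → 0 < obar →
    (∀ x y, Commute (o x) (o y)) → (∀ x y, y ∉ supp x → Commute (h x) (o y)) →
    (∀ x, (supp x).card ≤ r) →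
    ‖Φ‖ = 1 → (∑ x, h x) Φ = (EΛ : ℂ) • Φ → (∀ ψ : E, ‖ψ‖ = 1 → EΛ ≤ (⟪ψ, (∑ x, h x) ψ⟫_ℂ).re) →
    ⟪Φ, (∑ x, o x) Φ⟫_ℂ = 0 → 0 < μ → μ ≤ 1 →
    (μ * obar * Fintype.card Λ) ^ 2 ≤ (⟪Φ, (∑ x, o x) ((∑ x, o x) Φ)⟫_ℂ).re →
      ∃ (Φ₁ : E) (E₁ : ℝ), Φ₁ ≠ 0 ∧ ⟪Φ, Φ₁⟫_ℂ = 0 ∧ (∑ x, h x) Φ₁ = (E₁ : ℂ) • Φ₁ ∧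
        E₁ - EΛ ≤ (2 * (r : ℝ) ^ 2 * hbar / μ ^ 2) / Fintype.card Λ

/-! ### Theorem 2.3 (first main theorem: `U(1)` symmetry) -/

/-- **KT Theorem 2.3.** There is a constant `c₁ = c₁(h, r, μ)` such that for every `U(1)` system
satisfying i)–iii), every `Φ`, `E`, `μ` satisfying iv), if `N ≥ (4r/μ)²` (2.20) and
`0 ≠ M ∈ ℤ` with `|M|/N ≤ μ²/(8r)` (2.21) (written multiplied out, `|M| ≤ (μ²/(8r)) N`), then
`(O^+)^M Φ ≠ 0` (so `Ψ^{(M)}` (2.19) is well defined; here `o > 0` of iii) is used) and `(1/N) |⟨Ψ^{(M)}, H_Λ Ψ^{(M)}⟩ - E| ≤ c₁ |M| / N` (2.22), i.e.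
`|⟨Ψ^{(M)}, H_Λ Ψ^{(M)}⟩ - E| ≤ c₁ |M|`. Hence `{Ψ^{(M)}_Λ}_Λ` at fixed `M` are "low-lying states"
(Def. 2.1). [cite: KomaTasaki1994, Theorem 2.3 (2.20)–(2.22)] -/
def theorem_2_3 : Prop :=
  ∃ c₁ : ℝ → ℕ → ℝ → ℝ,
    ∀ {Λ : Type u} [Fintype Λ] {E : Type v} [NormedAddCommGroup E] [InnerProductSpace ℂ E]
      [FiniteDimensional ℂ E]
      (sys : U1System Λ E) (Φ : E) (EΛ μ : ℝ), IsLROEigenstate sys Φ EΛ μ →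
      (4 * sys.r / μ) ^ 2 ≤ (Fintype.card Λ : ℝ) →
      ∀ M : ℤ, M ≠ 0 → (|M| : ℝ) ≤ μ ^ 2 / (8 * sys.r) * Fintype.card Λ →
        sys.orderPow M Φ ≠ 0 ∧
          |(⟪sys.trialState M Φ, sys.hamiltonian (sys.trialState M Φ)⟫_ℂ).re - EΛ| ≤
            c₁ sys.hbar sys.r μ * |M|

/-! ### Theorem 2.4 (second main theorem: `U(1) × ℤ₂` symmetry and the Anderson tower) -/

/-- **KT Theorem 2.4.** Assume in addition v) `[O^{(1)}, O^{(2)}] = i γ C_Λ` (2.23) (so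
`(γ^{-1/2} O^{(1)}, γ^{-1/2} O^{(2)}, C)` generate `SU(2)`; we take `γ > 0`) and vi)
`U H U⁻¹ = H`, `U Φ ∝ Φ` for the `π`-rotation `U = exp[i (π/√γ) O^{(1)}]` about the first axis.
There is `c₃ = c₃(h, o, r, μ, γ)` such that whenever `0 ≠ M ∈ ℤ` and
`M²/N ≤ c₂ = min{μ²/(192 r), o μ / √(24 γ)}` (2.24) (written multiplied out, `M² ≤ c₂ N`, so
that the empty lattice is not admitted through the junk value `M²/0 = 0`), `(O^+)^M Φ ≠ 0` and
`|⟨Ψ^{(M)}, H_Λ Ψ^{(M)}⟩ - E| ≤ c₃ M² / N` (2.25): a tower of low-lying states with excitation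
energies `O(M²/N)`. [cite: KomaTasaki1994, Theorem 2.4 (2.23)–(2.25)] -/
def theorem_2_4 : Prop :=
  ∃ c₃ : ℝ → ℝ → ℕ → ℝ → ℝ → ℝ,
    ∀ {Λ : Type u} [Fintype Λ] {E : Type v} [NormedAddCommGroup E] [InnerProductSpace ℂ E]
      [FiniteDimensional ℂ E]
      (sys : U1System Λ E) (Φ : E) (EΛ μ : ℝ), IsLROEigenstate sys Φ EΛ μ →
      ∀ γ : ℝ, 0 < γ →
      sys.order 0 * sys.order 1 - sys.order 1 * sys.order 0 = (I * γ) • sys.C →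
      NormedSpace.exp ((I * ↑(Real.pi / Real.sqrt γ)) • sys.order 0) * sys.hamiltonian =
        sys.hamiltonian * NormedSpace.exp ((I * ↑(Real.pi / Real.sqrt γ)) • sys.order 0) →
      (∃ c : ℂ, NormedSpace.exp ((I * ↑(Real.pi / Real.sqrt γ)) • sys.order 0) Φ = c • Φ) →
      ∀ M : ℤ, M ≠ 0 →
        (M : ℝ) ^ 2 ≤
          min (μ ^ 2 / (192 * sys.r)) (sys.obar * μ / Real.sqrt (24 * γ)) * Fintype.card Λ →
        sys.orderPow M Φ ≠ 0 ∧
          |(⟪sys.trialState M Φ, sys.hamiltonian (sys.trialState M Φ)⟫_ℂ).re - EΛ| ≤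
            c₃ sys.hbar sys.obar sys.r μ γ * (M : ℝ) ^ 2 / Fintype.card Λ

/-! ### Theorem 2.5, finite-volume part -/

/-- **KT Theorem 2.5, (2.29).** Under i)–iv) with `Φ` the state of iv), for `k ≥ 1` and `Λ` so
large that (2.20)–(2.21) hold for all `|M| ≤ k` (i.e. `N ≥ (4r/μ)²` and `k ≤ (μ²/(8r)) N`), the
symmetry-breaking trial state `Ξ^{(k)}` (2.27) has `⟨Ξ^{(k)}, O^{(2)} Ξ^{(k)}⟩ = 0` (its order
parameter points along the first axis). The companion bound (2.30),
`lim_k lim_Λ N⁻¹ ⟨Ξ^{(k)}, O^{(1)} Ξ^{(k)}⟩ ≥ √2 μ o`, is an infinite-volume statement not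
vendored here. [cite: KomaTasaki1994, Theorem 2.5 (2.29)] -/
def theorem_2_5_orderTwo : Prop :=
  ∀ {Λ : Type u} [Fintype Λ] {E : Type v} [NormedAddCommGroup E] [InnerProductSpace ℂ E]
    [FiniteDimensional ℂ E]
    (sys : U1System Λ E) (Φ : E) (EΛ μ : ℝ), IsLROEigenstate sys Φ EΛ μ →
    (4 * sys.r / μ) ^ 2 ≤ (Fintype.card Λ : ℝ) →
    ∀ k : ℕ, 1 ≤ k → (k : ℝ) ≤ μ ^ 2 / (8 * sys.r) * Fintype.card Λ →
      ⟪sys.xiState k Φ, sys.order 1 (sys.xiState k Φ)⟫_ℂ = 0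

/-! ### Proved consequences -/

/-- (2.18): an eigenvector of `C` has vanishing order parameters, `⟨Φ, O^+ Φ⟩ = 0`, because
`O^+` shifts the `C`-charge by `-1` ((2.16): `C O^+ Φ = (c + 1) O^+ Φ`) and `C` is self-adjoint.
[cite: KomaTasaki1994, (2.18)] -/
theorem inner_orderPlus_eq_zero (sys : U1System Λ E) {Φ : E} {c : ℂ}
    (hC : sys.C Φ = c • Φ) : ⟪Φ, sys.orderPlus Φ⟫_ℂ = 0 := by
  by_cases hΦ : Φ = 0
  · simp [hΦ]
  -- `C (O⁺ Φ) = (c + 1) • O⁺ Φ` from (2.16)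
  have h1 : sys.C (sys.orderPlus Φ) = (c + 1) • sys.orderPlus Φ := by
    have h := congrArg (fun T : E →L[ℂ] E => T Φ) sys.orderPlus_commutator
    have h' : sys.orderPlus (sys.C Φ) - sys.C (sys.orderPlus Φ) = -sys.orderPlus Φ := h
    rw [hC, map_smul] at h'
    -- h' : c • O⁺Φ - C (O⁺Φ) = -O⁺Φ
    have h2 : sys.C (sys.orderPlus Φ) =
        c • sys.orderPlus Φ - (c • sys.orderPlus Φ - sys.C (sys.orderPlus Φ)) := by abel
    rw [h2, h', add_smul, one_smul, sub_neg_eq_add]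
  -- `c` is real since `C` is symmetric and `Φ ≠ 0`
  have hc : conj c = c := by
    have h3 : ⟪sys.C Φ, Φ⟫_ℂ = ⟪Φ, sys.C Φ⟫_ℂ := sys.isSymmetric_C Φ Φ
    rw [hC, inner_smul_right, inner_smul_left] at h3
    exact mul_left_injective₀ (inner_self_ne_zero.mpr hΦ) h3
  -- `⟪C Φ, O⁺Φ⟫ = ⟪Φ, C O⁺ Φ⟫` gives `conj c • t = (c + 1) • t`
  have h4 : ⟪sys.C Φ, sys.orderPlus Φ⟫_ℂ = ⟪Φ, sys.C (sys.orderPlus Φ)⟫_ℂ :=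
    sys.isSymmetric_C Φ (sys.orderPlus Φ)
  rw [hC, h1, inner_smul_left, inner_smul_right, hc] at h4
  have h5 : (c + 1 - c) * ⟪Φ, sys.orderPlus Φ⟫_ℂ = 0 := by
    rw [sub_mul]; exact sub_eq_zero.mpr h4.symm
  simpa using h5

/-- Theorem 2.3 at `M = 1` gives in particular that `O^+ Φ ≠ 0`: an LRO eigenstate is not
annihilated by the raising operator (for `N ≥ (4r/μ)²` and `N ≥ 8r/μ²`).
[cite: KomaTasaki1994, Theorem 2.3] -/
theorem orderPlus_apply_ne_zero (h23 : theorem_2_3.{u, v}) [FiniteDimensional ℂ E]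
    (sys : U1System Λ E) {Φ : E} {EΛ μ : ℝ} (hΦ : IsLROEigenstate sys Φ EΛ μ)
    (hN : (4 * sys.r / μ) ^ 2 ≤ (Fintype.card Λ : ℝ))
    (hN' : (1 : ℝ) ≤ μ ^ 2 / (8 * sys.r) * Fintype.card Λ) :
    sys.orderPlus Φ ≠ 0 := by
  obtain ⟨c₁, hc₁⟩ := h23
  have := (hc₁ sys Φ EΛ μ hΦ hN 1 one_ne_zero (by simpa using hN')).1
  simpa using this

/-- With `o > 0` (iii)), `μ > 0` and `N ≥ 1`, the long-range order (2.17) forces `O^{(1)} Φ ≠ 0`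
(indeed `‖O^{(1)} Φ‖² = ⟨Φ, (O^{(1)})² Φ⟩ ≥ (μ o N)² > 0`); this is the non-vacuity behind
"`Ψ` is well defined" in KT Theorem 2.2. [cite: KomaTasaki1994, Theorem 2.2] -/
theorem IsLROEigenstate.order_zero_apply_ne_zero [Nonempty Λ] {sys : U1System Λ E} {Φ : E}
    {EΛ μ : ℝ} (hΦ : IsLROEigenstate sys Φ EΛ μ) : sys.order 0 Φ ≠ 0 := by
  intro h0
  have hpos : 0 < (μ * sys.obar * Fintype.card Λ) ^ 2 := by
    have : (0 : ℝ) < Fintype.card Λ := Nat.cast_pos.mpr Fintype.card_pos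
    have := mul_pos (mul_pos hΦ.mu_pos sys.obar_pos) this
    positivity
  have := hΦ.lro
  rw [h0, map_zero, inner_zero_right, Complex.zero_re] at this
  linarith

/-! ### Proof of Theorem 2.2, first part: `horschVonDerLinden_holds`

KT's two-line argument (p. 747 of the journal version, after (2.9)): with `Ψ = OΦ/‖OΦ‖`,
`⟨Ψ, HΨ⟩ - E = ⟨Φ, O(H - E)OΦ⟩/‖OΦ‖² = ⟨Φ, [[O, H], O]Φ⟩/(2‖OΦ‖²)` (using `HΦ = EΦ` and the
self-adjointness of `H`, `O`), `‖OΦ‖² = ⟨Φ, O²Φ⟩ ≥ (μ o N)²` by (2.7), and the double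
commutator is a sum of `≤ N r²` terms `[[o_y, h_x], o_z]`, `y, z ∈ S_x`, each of norm
`≤ 4 h o²` (all other terms vanish by `[o_y, o_z] = 0` and `[h_x, o_z] = 0` for `z ∉ S_x`), so
`|⟨Ψ, HΨ⟩ - E| ≤ 4 N r² h o² / (2 μ² o² N²) = 2 r² h μ⁻² / N`. -/

/-- In any ring, `[[A, B], C] = 0` when `C` commutes with `A` and with `B`. [folklore] -/
theorem comm_comm_eq_zero {R : Type*} [Ring R] {A B C : R} (hAC : Commute A C)
    (hBC : Commute B C) : (A * B - B * A) * C - C * (A * B - B * A) = 0 :=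
  sub_eq_zero.mpr ((hAC.mul_left hBC).sub_left (hBC.mul_left hAC)).eq

omit [Fintype Λ] in
/-- The norm of a double commutator: `‖[[A, B], C]‖ ≤ 4 ‖A‖ ‖B‖ ‖C‖`. [folklore] -/
theorem norm_comm_comm_le (A B C : E →L[ℂ] E) :
    ‖(A * B - B * A) * C - C * (A * B - B * A)‖ ≤ 4 * ‖A‖ * ‖B‖ * ‖C‖ := by
  have hK : ‖A * B - B * A‖ ≤ 2 * ‖A‖ * ‖B‖ :=
    calc ‖A * B - B * A‖ ≤ ‖A * B‖ + ‖B * A‖ := norm_sub_le _ _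
      _ ≤ ‖A‖ * ‖B‖ + ‖B‖ * ‖A‖ := add_le_add (norm_mul_le _ _) (norm_mul_le _ _)
      _ = 2 * ‖A‖ * ‖B‖ := by ring
  calc ‖(A * B - B * A) * C - C * (A * B - B * A)‖
      ≤ ‖(A * B - B * A) * C‖ + ‖C * (A * B - B * A)‖ := norm_sub_le _ _
    _ ≤ ‖A * B - B * A‖ * ‖C‖ + ‖C‖ * ‖A * B - B * A‖ :=
        add_le_add (norm_mul_le _ _) (norm_mul_le _ _)
    _ ≤ (2 * ‖A‖ * ‖B‖) * ‖C‖ + ‖C‖ * (2 * ‖A‖ * ‖B‖) := by gcongr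
    _ = 4 * ‖A‖ * ‖B‖ * ‖C‖ := by ring

omit [Fintype Λ] in
/-- The energy expectation of the normalised vector `v/‖v‖` is `re ⟪v, T v⟫ / ‖v‖²`.
[folklore] -/
theorem re_inner_normalize_apply (T : E →L[ℂ] E) (v : E) :
    (⟪(‖v‖⁻¹ : ℂ) • v, T ((‖v‖⁻¹ : ℂ) • v)⟫_ℂ).re = (⟪v, T v⟫_ℂ).re / ‖v‖ ^ 2 := by
  rw [map_smul, inner_smul_left, inner_smul_right, ← mul_assoc]
  have hc : (starRingEnd ℂ) (‖v‖⁻¹ : ℂ) * (‖v‖⁻¹ : ℂ) = ((‖v‖⁻¹ * ‖v‖⁻¹ : ℝ) : ℂ) := by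
    push_cast
    rw [map_inv₀, Complex.conj_ofReal]
  rw [hc, Complex.re_ofReal_mul]
  ring

/-- **KT Theorem 2.2 (Horsch–von der Linden), first part — PROVED.** The named fact
`horschVonDerLinden` holds: under the hypotheses listed there, `O Φ ≠ 0` and the normalised
state `Ψ = OΦ/‖OΦ‖` has `|⟨Ψ, H Ψ⟩ - E| ≤ (2 r² h / μ²) / N`. The proof is KT's: the
double-commutator identity `⟨Φ, [[O,H],O] Φ⟩ = 2(⟨OΦ, H OΦ⟩ - E ‖OΦ‖²)`, locality
`[[O, H], O] = Σ_x Σ_{y,z ∈ S_x} [[o_y, h_x], o_z]` (hypotheses `[o_x, o_y] = 0`,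
`[h_x, o_y] = 0` for `y ∉ S_x`), the norm bound `4 h o²` per term, and `‖OΦ‖² ≥ (μ o N)²`.
[cite: KomaTasaki1994, Theorem 2.2 (2.9)] -/
theorem horschVonDerLinden_holds : horschVonDerLinden.{u, v} := by
  intro Λ _ _ E _ _ _ h o supp r hbar obar μ Φ EΛ hhsym hosym hhb hob hobpos hoo hho hsupp hΦ1 hHΦ
    _hOΦ hμ _hμ1 hlro
  set O : E →L[ℂ] E := ∑ x, o x with hOdef
  set H : E →L[ℂ] E := ∑ x, h x with hHdef
  have hN : (0 : ℝ) < Fintype.card Λ := Nat.cast_pos.mpr Fintype.card_pos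
  have hhbar : 0 ≤ hbar := (norm_nonneg _).trans (hhb (Classical.arbitrary Λ))
  -- self-adjointness of `O` and `H`
  have hOsym : ∀ φ ψ : E, ⟪O φ, ψ⟫_ℂ = ⟪φ, O ψ⟫_ℂ := by
    intro φ ψ
    simp only [hOdef, FunLike.coe_sum, Finset.sum_apply, sum_inner, inner_sum]
    exact Finset.sum_congr rfl fun x _ => hosym x φ ψ
  have hHsym : ∀ φ ψ : E, ⟪H φ, ψ⟫_ℂ = ⟪φ, H ψ⟫_ℂ := by
    intro φ ψ
    simp only [hHdef, FunLike.coe_sum, Finset.sum_apply, sum_inner, inner_sum]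
    exact Finset.sum_congr rfl fun x _ => hhsym x φ ψ
  -- Step 1: `‖OΦ‖² = ⟨Φ, O²Φ⟩ ≥ (μ o N)² > 0`
  have hb : (⟪O Φ, O Φ⟫_ℂ).re = ‖O Φ‖ ^ 2 := by
    rw [← inner_self_eq_norm_sq (𝕜 := ℂ) (O Φ), RCLike.re_to_complex]
  have hnormsq : (⟪Φ, O (O Φ)⟫_ℂ).re = ‖O Φ‖ ^ 2 := by rw [← hOsym, hb]
  have hnorm2_ge : (μ * obar * Fintype.card Λ) ^ 2 ≤ ‖O Φ‖ ^ 2 := hnormsq ▸ hlro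
  have hpos : 0 < (μ * obar * Fintype.card Λ) ^ 2 := by positivity
  have hOΦ_ne : O Φ ≠ 0 := by
    intro h0
    rw [h0, norm_zero] at hnorm2_ge
    linarith
  have hn2 : (0 : ℝ) < ‖O Φ‖ ^ 2 := by
    have := norm_pos_iff.mpr hOΦ_ne
    positivity
  refine ⟨hOΦ_ne, ?_⟩
  -- Step 2: the double commutator and the energy identity
  set D : E →L[ℂ] E := (O * H - H * O) * O - O * (O * H - H * O) with hDdef
  have hD_inner : ⟪Φ, D Φ⟫_ℂ = 2 * (⟪O Φ, H (O Φ)⟫_ℂ - (EΛ : ℂ) * ⟪O Φ, O Φ⟫_ℂ) := by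
    have h1 : ⟪Φ, O (H (O Φ))⟫_ℂ = ⟪O Φ, H (O Φ)⟫_ℂ := (hOsym Φ _).symm
    have h2 : ⟪Φ, H (O (O Φ))⟫_ℂ = (EΛ : ℂ) * ⟪O Φ, O Φ⟫_ℂ := by
      rw [← hHsym, hHΦ, inner_smul_left, Complex.conj_ofReal, ← hOsym]
    have h3 : ⟪Φ, O (O (H Φ))⟫_ℂ = (EΛ : ℂ) * ⟪O Φ, O Φ⟫_ℂ := by
      rw [hHΦ, map_smul, map_smul, inner_smul_right, ← hOsym]
    simp only [hDdef, sub_apply, mul_apply_eq_comp, map_sub, inner_sub_right, h1, h2, h3]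
    ring
  -- Step 3: locality of the double commutator
  have hcommOH : O * H - H * O = ∑ x, ∑ y ∈ supp x, (o y * h x - h x * o y) := by
    have e1 : O * H - H * O = ∑ x, (O * h x - h x * O) := by
      simp only [hHdef, Finset.mul_sum, Finset.sum_mul, Finset.sum_sub_distrib]
    rw [e1]
    refine Finset.sum_congr rfl fun x _ => ?_
    have e2 : O * h x - h x * O = ∑ y, (o y * h x - h x * o y) := by
      simp only [hOdef, Finset.sum_mul, Finset.mul_sum, Finset.sum_sub_distrib]
    rw [e2]
    exact (Finset.sum_subset (Finset.subset_univ _)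
      (fun y _ hy => sub_eq_zero.mpr (hho x y hy).eq.symm)).symm
  have hD_local : D = ∑ x, ∑ y ∈ supp x, ∑ z ∈ supp x,
      ((o y * h x - h x * o y) * o z - o z * (o y * h x - h x * o y)) := by
    rw [hDdef, hcommOH]
    simp only [Finset.sum_mul, Finset.mul_sum, ← Finset.sum_sub_distrib]
    refine Finset.sum_congr rfl fun x _ => Finset.sum_congr rfl fun y _ => ?_
    rw [hOdef]
    simp only [Finset.sum_mul, Finset.mul_sum, ← Finset.sum_sub_distrib]
    exact (Finset.sum_subset (Finset.subset_univ _)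
      (fun z _ hz => comm_comm_eq_zero (hoo y z) (hho x z hz))).symm
  -- Step 4: the norm bound `‖D‖ ≤ 4 r² h o² N`
  have hterm : ∀ x y z, ‖(o y * h x - h x * o y) * o z - o z * (o y * h x - h x * o y)‖ ≤
      4 * hbar * obar ^ 2 := by
    intro x y z
    calc ‖(o y * h x - h x * o y) * o z - o z * (o y * h x - h x * o y)‖
        ≤ 4 * ‖o y‖ * ‖h x‖ * ‖o z‖ := norm_comm_comm_le _ _ _
      _ ≤ 4 * obar * hbar * obar := by
          have := hob y; have := hob z; have := hhb x
          gcongr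
      _ = 4 * hbar * obar ^ 2 := by ring
  have hD_norm : ‖D‖ ≤ 4 * (r : ℝ) ^ 2 * hbar * obar ^ 2 * Fintype.card Λ := by
    rw [hD_local]
    calc ‖∑ x, ∑ y ∈ supp x, ∑ z ∈ supp x,
            ((o y * h x - h x * o y) * o z - o z * (o y * h x - h x * o y))‖
        ≤ ∑ x, ∑ y ∈ supp x, ∑ z ∈ supp x, (4 * hbar * obar ^ 2) := by
          refine (norm_sum_le _ _).trans (Finset.sum_le_sum fun x _ => ?_)
          refine (norm_sum_le _ _).trans (Finset.sum_le_sum fun y _ => ?_)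
          exact (norm_sum_le _ _).trans (Finset.sum_le_sum fun z _ => hterm x y z)
      _ = ∑ x, ((supp x).card : ℝ) ^ 2 * (4 * hbar * obar ^ 2) := by
          refine Finset.sum_congr rfl fun x _ => ?_
          simp only [Finset.sum_const, nsmul_eq_mul]
          ring
      _ ≤ ∑ _x : Λ, (r : ℝ) ^ 2 * (4 * hbar * obar ^ 2) := by
          refine Finset.sum_le_sum fun x _ => ?_
          have hx : ((supp x).card : ℝ) ≤ r := by exact_mod_cast hsupp x
          gcongr
      _ = 4 * (r : ℝ) ^ 2 * hbar * obar ^ 2 * Fintype.card Λ := by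
          simp only [Finset.sum_const, Finset.card_univ, nsmul_eq_mul]
          ring
  -- Step 5: `|⟨Φ, DΦ⟩| ≤ ‖D‖`
  have hinner_le : |(⟪Φ, D Φ⟫_ℂ).re| ≤ ‖D‖ :=
    calc |(⟪Φ, D Φ⟫_ℂ).re| ≤ ‖⟪Φ, D Φ⟫_ℂ‖ := Complex.abs_re_le_norm _
      _ ≤ ‖Φ‖ * ‖D Φ‖ := norm_inner_le_norm _ _
      _ ≤ ‖Φ‖ * (‖D‖ * ‖Φ‖) := by gcongr; exact D.le_opNorm Φ
      _ = ‖D‖ := by rw [hΦ1]; ring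
  -- Step 6: assemble
  have hAB : (⟪O Φ, H (O Φ)⟫_ℂ).re - EΛ * ‖O Φ‖ ^ 2 = (⟪Φ, D Φ⟫_ℂ).re / 2 := by
    have h2 := congrArg Complex.re hD_inner
    simp only [Complex.mul_re, Complex.sub_re, Complex.sub_im, Complex.ofReal_re,
      Complex.ofReal_im, Complex.re_ofNat, Complex.im_ofNat, zero_mul, sub_zero] at h2
    rw [hb] at h2
    linarith
  rw [re_inner_normalize_apply]
  have hkey : (⟪O Φ, H (O Φ)⟫_ℂ).re / ‖O Φ‖ ^ 2 - EΛ =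
      (⟪Φ, D Φ⟫_ℂ).re / (2 * ‖O Φ‖ ^ 2) := by
    rw [eq_div_iff (by positivity)]
    calc ((⟪O Φ, H (O Φ)⟫_ℂ).re / ‖O Φ‖ ^ 2 - EΛ) * (2 * ‖O Φ‖ ^ 2)
        = 2 * ((⟪O Φ, H (O Φ)⟫_ℂ).re / ‖O Φ‖ ^ 2 * ‖O Φ‖ ^ 2) - 2 * (EΛ * ‖O Φ‖ ^ 2) := by
          ring
      _ = 2 * ((⟪O Φ, H (O Φ)⟫_ℂ).re - EΛ * ‖O Φ‖ ^ 2) := by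
          rw [div_mul_cancel₀ _ hn2.ne']; ring
      _ = (⟪Φ, D Φ⟫_ℂ).re := by rw [hAB]; ring
  rw [hkey, abs_div, abs_of_pos (by positivity : (0 : ℝ) < 2 * ‖O Φ‖ ^ 2)]
  calc |(⟪Φ, D Φ⟫_ℂ).re| / (2 * ‖O Φ‖ ^ 2)
      ≤ (4 * (r : ℝ) ^ 2 * hbar * obar ^ 2 * Fintype.card Λ) /
          (2 * (μ * obar * Fintype.card Λ) ^ 2) := by
        gcongr
        · exact hinner_le.trans hD_norm
    _ = 2 * (r : ℝ) ^ 2 * hbar / μ ^ 2 / Fintype.card Λ := by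
        field_simp
        ring

/-! ### Proof of Theorem 2.2, second part: `horschVonDerLinden_eigenstate_holds`

KT: "`Ψ` is orthogonal to `Φ` because of (2.6), and the lemma follows from the standard
variational argument" — i.e. `H` leaves `Φ^⊥` invariant (`HΦ = EΦ`, `H` self-adjoint), the
bottom of the spectrum of `H|_{Φ^⊥}` is attained at an eigenvector `Φ₁ ⊥ Φ` (finite dimension:
minimise the Rayleigh quotient on a sphere, Mathlib's `IsSelfAdjoint.hasEigenvector_of_isMinOn`),
and its eigenvalue is at most the Rayleigh quotient of `Ψ = OΦ/‖OΦ‖ ∈ Φ^⊥`, which the first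
part bounds by `E + c₀/N`. (The ground-state hypothesis is not needed for this conclusion.) -/

/-- **KT Theorem 2.2 (Horsch–von der Linden), second part — PROVED.** The named fact
`horschVonDerLinden_eigenstate` holds: there is an eigenvector `Φ₁ ⊥ Φ` of `H_Λ` with
eigenvalue `E₁ ≤ E + (2 r² h / μ²)/N` (2.10). [cite: KomaTasaki1994, Theorem 2.2 (2.10)] -/
theorem horschVonDerLinden_eigenstate_holds : horschVonDerLinden_eigenstate.{u, v} := by
  intro Λ _ _ E _ _ _ h o supp r hbar obar μ Φ EΛ hhsym hosym hhb hob hobpos hoo hho hsupp hΦ1 hHΦ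
    _hground hOΦ hμ hμ1 hlro
  obtain ⟨hne, hbound⟩ := horschVonDerLinden_holds h o supp r hbar obar μ Φ EΛ hhsym hosym hhb
    hob hobpos hoo hho hsupp hΦ1 hHΦ hOΦ hμ hμ1 hlro
  set O : E →L[ℂ] E := ∑ x, o x with hOdef
  set H : E →L[ℂ] E := ∑ x, h x with hHdef
  have hHsym : ∀ φ ψ : E, ⟪H φ, ψ⟫_ℂ = ⟪φ, H ψ⟫_ℂ := by
    intro φ ψ
    simp only [hHdef, FunLike.coe_sum, Finset.sum_apply, sum_inner, inner_sum]
    exact Finset.sum_congr rfl fun x _ => hhsym x φ ψ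
  -- the invariant subspace `K = Φ^⊥` and the restriction `T = H|_K`
  set K : Submodule ℂ E := (ℂ ∙ Φ)ᗮ with hKdef
  have hmemK : ∀ v : E, v ∈ K ↔ ⟪Φ, v⟫_ℂ = 0 := fun v =>
    Submodule.mem_orthogonal_singleton_iff_inner_right
  have hinv : ∀ v ∈ K, (H : E →ₗ[ℂ] E) v ∈ K := by
    intro v hv
    rw [hmemK] at hv ⊢
    change ⟪Φ, H v⟫_ℂ = 0
    rw [← hHsym, hHΦ, inner_smul_left, hv, mul_zero]
  set T : K →ₗ[ℂ] K := (H : E →ₗ[ℂ] E).restrict hinv with hTdef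
  have hT : T.IsSymmetric := by
    intro v w
    rw [Submodule.coe_inner, Submodule.coe_inner, hTdef, LinearMap.coe_restrict_apply,
      LinearMap.coe_restrict_apply]
    exact hHsym v w
  -- the vector `OΦ ∈ K`
  have hψK : O Φ ∈ K := (hmemK _).2 hOΦ
  set ψ' : K := ⟨O Φ, hψK⟩ with hψ'def
  have hψ'ne : ψ' ≠ 0 := fun h0 => hne (congrArg Subtype.val h0)
  have hψ'norm : ‖ψ'‖ = ‖O Φ‖ := rfl
  -- minimise the Rayleigh quotient of `T` on the sphere through `ψ'`
  haveI : CompleteSpace K := FiniteDimensional.complete ℂ K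
  haveI := FiniteDimensional.proper_rclike ℂ K
  have H₁ : IsCompact (Metric.sphere (0 : K) ‖ψ'‖) := isCompact_sphere _ _
  have H₂ : (Metric.sphere (0 : K) ‖ψ'‖).Nonempty := ⟨ψ', by simp⟩
  obtain ⟨x₀, hx₀', hTx₀⟩ :=
    H₁.exists_isMinOn H₂ (hT.toSelfAdjoint).val.reApplyInnerSelf_continuous.continuousOn
  have hx₀ : ‖x₀‖ = ‖ψ'‖ := by simpa using hx₀'
  have hmin : IsMinOn (hT.toSelfAdjoint).val.reApplyInnerSelf (Metric.sphere 0 ‖x₀‖) x₀ := by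
    simpa only [← hx₀] using hTx₀
  have hx₀_ne : x₀ ≠ 0 := by
    intro h0
    rw [h0, norm_zero] at hx₀
    exact hψ'ne (norm_eq_zero.mp hx₀.symm)
  have hev := (hT.toSelfAdjoint).prop.hasEigenvector_of_isLocalExtrOn hx₀_ne
    (Or.inl hmin.localize)
  -- the eigenpair
  refine ⟨(x₀ : E), (hT.toSelfAdjoint).val.rayleighQuotient x₀, ?_, ?_, ?_, ?_⟩
  · exact fun h0 => hx₀_ne (Subtype.ext h0)
  · exact (hmemK _).1 x₀.2
  · have h1 := hev.apply_eq_smul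
    have h2 : (((hT.toSelfAdjoint).val : K →ₗ[ℂ] K) x₀ : E) = H x₀ := rfl
    rw [← h2, h1, Submodule.coe_smul]
    rfl
  · -- `λ(x₀) ≤ λ(ψ') = re ⟪Ψ, HΨ⟫ ≤ E + c₀/N`
    have hle : (hT.toSelfAdjoint).val.reApplyInnerSelf x₀ ≤
        (hT.toSelfAdjoint).val.reApplyInnerSelf ψ' := hmin (by simp [hx₀])
    have hrayψ : (hT.toSelfAdjoint).val.reApplyInnerSelf ψ' =
        (⟪O Φ, H (O Φ)⟫_ℂ).re := by
      rw [ContinuousLinearMap.reApplyInnerSelf_apply, RCLike.re_to_complex, Submodule.coe_inner]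
      change (⟪H (O Φ), O Φ⟫_ℂ).re = _
      rw [hHsym]
    have hray : (hT.toSelfAdjoint).val.rayleighQuotient x₀ ≤
        (⟪O Φ, H (O Φ)⟫_ℂ).re / ‖O Φ‖ ^ 2 := by
      rw [ContinuousLinearMap.rayleighQuotient, hx₀, hψ'norm, ← hrayψ]
      gcongr
    have hre := re_inner_normalize_apply H (O Φ)
    have h3 := (abs_sub_le_iff.1 hbound).1
    rw [hre] at h3
    linarith

/-! ### Proof of Theorem 2.5, (2.29): `theorem_2_5_orderTwo_holds`

KT's "outline of proof" (KT §2.4, proof of Theorem 2.5; arXiv:cond-mat/9708132): expand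
`⟨Ξ^{(k)}, O^+ Ξ^{(k)}⟩ = (2k+1)⁻¹ Σ_{M,M'=-k}^{k} ⟨Ψ^{(M)}, O^+ Ψ^{(M')}⟩`; since `Φ` is an
eigenstate of `C` and `O^±` are raising/lowering operators for the charge defined by `C`
((2.16)), `Ψ^{(M)}` has charge `c + M` and only the terms `M = M' + 1` survive; each surviving
term is `‖(O^+)^{M'+1}Φ‖² / (‖(O^+)^{M'+1}Φ‖ ‖(O^+)^{M'}Φ‖)` (for `M' ≥ 0`) or
`‖(O^-)^{|M'|}Φ‖² / (…)` (for `M' < 0`, using `(O^+)^* = O^-`), hence real. The same holds for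
`O^-`, so `⟨Ξ, O^+ Ξ⟩ = ⟨Ξ, O^- Ξ⟩` and `⟨Ξ, O^{(2)} Ξ⟩ = ⟨Ξ, (O^+ - O^-) Ξ⟩/(2i) = 0`.
We run the equivalent bookkeeping: `⟨Ξ, O^{(2)} Ξ⟩` is real (`O^{(2)}` symmetric) and equals
`Im ⟨Ξ, O^+ Ξ⟩` (as `O^+ = O^{(1)} + i O^{(2)}` with `⟨Ξ, O^{(1)} Ξ⟩` real), and
`Im ⟨Ψ^{(M)}, O^+ Ψ^{(M')}⟩ = 0` for all `M, M'` by the charge/reality dichotomy above. The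
size conditions (2.20)–(2.21) (which in KT only guarantee `Ψ^{(M)} ≠ 0`) and the energy
eigenvalue equation are not used: with Lean's junk value `Ψ^{(M)} = 0` when `(O^+)^M Φ = 0`
the identity holds verbatim. -/

namespace U1System

variable (sys : U1System Λ E)

/-- `O^-` is the adjoint of `O^+`: `⟪O^- x, y⟫ = ⟪x, O^+ y⟫` (`O^{(α)}` self-adjoint).
[cite: KomaTasaki1994, (2.15)] -/
theorem inner_orderMinus_left (x y : E) :
    ⟪sys.orderMinus x, y⟫_ℂ = ⟪x, sys.orderPlus y⟫_ℂ := by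
  have h0 : ⟪sys.order 0 x, y⟫_ℂ = ⟪x, sys.order 0 y⟫_ℂ := sys.isSymmetric_order 0 x y
  have h1 : ⟪sys.order 1 x, y⟫_ℂ = ⟪x, sys.order 1 y⟫_ℂ := sys.isSymmetric_order 1 x y
  simp only [orderMinus, orderPlus, sub_apply, add_apply,
    smul_apply, inner_sub_left, inner_add_right, inner_smul_left,
    inner_smul_right, Complex.conj_I, h0, h1]
  ring

/-- `O^+` is the adjoint of `O^-`: `⟪O^+ x, y⟫ = ⟪x, O^- y⟫`. [cite: KomaTasaki1994, (2.15)] -/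
theorem inner_orderPlus_left (x y : E) :
    ⟪sys.orderPlus x, y⟫_ℂ = ⟪x, sys.orderMinus y⟫_ℂ := by
  have h0 : ⟪sys.order 0 x, y⟫_ℂ = ⟪x, sys.order 0 y⟫_ℂ := sys.isSymmetric_order 0 x y
  have h1 : ⟪sys.order 1 x, y⟫_ℂ = ⟪x, sys.order 1 y⟫_ℂ := sys.isSymmetric_order 1 x y
  simp only [orderMinus, orderPlus, sub_apply, add_apply,
    smul_apply, inner_add_left, inner_sub_right, inner_smul_left,
    inner_smul_right, Complex.conj_I, h0, h1]
  ring

/-- `O^+` raises the `C`-charge by one: `C (O^+ u) = (a + 1) O^+ u` if `C u = a u` ((2.16)).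
[cite: KomaTasaki1994, (2.16)] -/
theorem C_orderPlus_apply {u : E} {a : ℂ} (hu : sys.C u = a • u) :
    sys.C (sys.orderPlus u) = (a + 1) • sys.orderPlus u := by
  have h := congrArg (fun T : E →L[ℂ] E => T u) sys.orderPlus_commutator
  have h' : sys.orderPlus (sys.C u) - sys.C (sys.orderPlus u) = -sys.orderPlus u := h
  rw [hu, map_smul] at h'
  have h2 : sys.C (sys.orderPlus u) =
      a • sys.orderPlus u - (a • sys.orderPlus u - sys.C (sys.orderPlus u)) := by abel
  rw [h2, h', add_smul, one_smul, sub_neg_eq_add]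

/-- `O^-` lowers the `C`-charge by one: `C (O^- u) = (a - 1) O^- u` if `C u = a u` ((2.16)).
[cite: KomaTasaki1994, (2.16)] -/
theorem C_orderMinus_apply {u : E} {a : ℂ} (hu : sys.C u = a • u) :
    sys.C (sys.orderMinus u) = (a - 1) • sys.orderMinus u := by
  have h := congrArg (fun T : E →L[ℂ] E => T u) sys.orderMinus_commutator
  have h' : sys.orderMinus (sys.C u) - sys.C (sys.orderMinus u) = sys.orderMinus u := h
  rw [hu, map_smul] at h'
  have h2 : sys.C (sys.orderMinus u) =
      a • sys.orderMinus u - (a • sys.orderMinus u - sys.C (sys.orderMinus u)) := by abel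
  rw [h2, h', sub_smul, one_smul]

/-- `C ((O^+)^n u) = (a + n) (O^+)^n u` if `C u = a u`. [cite: KomaTasaki1994, (2.16)] -/
theorem C_orderPlus_pow_apply {u : E} {a : ℂ} (hu : sys.C u = a • u) (n : ℕ) :
    sys.C ((sys.orderPlus ^ n) u) = (a + n) • (sys.orderPlus ^ n) u := by
  induction n with
  | zero => simpa using hu
  | succ n ih =>
    rw [pow_succ', mul_apply_eq_comp, sys.C_orderPlus_apply ih]
    congr 1
    push_cast
    ring

/-- `C ((O^-)^n u) = (a - n) (O^-)^n u` if `C u = a u`. [cite: KomaTasaki1994, (2.16)] -/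
theorem C_orderMinus_pow_apply {u : E} {a : ℂ} (hu : sys.C u = a • u) (n : ℕ) :
    sys.C ((sys.orderMinus ^ n) u) = (a - n) • (sys.orderMinus ^ n) u := by
  induction n with
  | zero => simpa using hu
  | succ n ih =>
    rw [pow_succ', mul_apply_eq_comp, sys.C_orderMinus_apply ih]
    congr 1
    push_cast
    ring

/-- The vector `(O^+)^M Φ` has `C`-charge `c + M` (`M ∈ ℤ`, with `(O^+)^M = (O^-)^{-M}` for
`M < 0`) when `C Φ = c Φ`. [cite: KomaTasaki1994, (2.16), proof of Theorem 2.5] -/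
theorem C_orderPow_apply {Φ : E} {c : ℂ} (hC : sys.C Φ = c • Φ) (M : ℤ) :
    sys.C (sys.orderPow M Φ) = (c + M) • sys.orderPow M Φ := by
  rcases le_or_gt 0 M with hM | hM
  · rw [sys.orderPow_of_nonneg hM, sys.C_orderPlus_pow_apply hC]
    congr 1
    rw [← Int.cast_natCast, Int.toNat_of_nonneg hM]
  · rw [sys.orderPow_of_neg hM, sys.C_orderMinus_pow_apply hC]
    congr 1
    rw [← Int.cast_natCast, Int.toNat_of_nonneg (by omega)]
    push_cast
    ring

/-- `(O^+)^{M+1} = O^+ (O^+)^M` for `M ≥ 0`. [cite: KomaTasaki1994, (2.19)] -/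
theorem orderPow_add_one_of_nonneg {M : ℤ} (hM : 0 ≤ M) :
    sys.orderPow (M + 1) = sys.orderPlus * sys.orderPow M := by
  rw [sys.orderPow_of_nonneg hM, sys.orderPow_of_nonneg (by omega), ← pow_succ']
  congr 1
  omega

/-- `(O^+)^{M-1} = O^- (O^+)^M` for `M ≤ 0` (i.e. `(O^-)^{|M|+1} = O^- (O^-)^{|M|}`).
[cite: KomaTasaki1994, (2.19)] -/
theorem orderPow_sub_one_of_nonpos {M : ℤ} (hM : M ≤ 0) :
    sys.orderPow (M - 1) = sys.orderMinus * sys.orderPow M := by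
  rcases eq_or_lt_of_le hM with rfl | hM'
  · rw [zero_sub, orderPow_neg_one, sys.orderPow_of_nonneg le_rfl]
    simp
  · rw [sys.orderPow_of_neg hM', sys.orderPow_of_neg (by omega), ← pow_succ']
    congr 1
    omega

/-- Eigenvectors of the symmetric operator `C` with eigenvalues `a, b`, `conj a ≠ b`, are
orthogonal. [folklore] -/
theorem inner_eq_zero_of_eigen_C {x y : E} {a b : ℂ} (hx : sys.C x = a • x)
    (hy : sys.C y = b • y) (hab : conj a ≠ b) : ⟪x, y⟫_ℂ = 0 := by
  have h : ⟪sys.C x, y⟫_ℂ = ⟪x, sys.C y⟫_ℂ := sys.isSymmetric_C x y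
  rw [hx, hy, inner_smul_left, inner_smul_right] at h
  have h2 : (conj a - b) * ⟪x, y⟫_ℂ = 0 := by
    rw [sub_mul]
    exact sub_eq_zero.mpr h
  exact (mul_eq_zero.mp h2).resolve_left (sub_ne_zero.mpr hab)

/-- Eigenvalues of the symmetric operator `C` are real. [folklore] -/
theorem conj_eq_of_eigen_C {Φ : E} {c : ℂ} (hΦ : Φ ≠ 0) (hC : sys.C Φ = c • Φ) :
    conj c = c := by
  have h3 : ⟪sys.C Φ, Φ⟫_ℂ = ⟪Φ, sys.C Φ⟫_ℂ := sys.isSymmetric_C Φ Φ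
  rw [hC, inner_smul_right, inner_smul_left] at h3
  exact mul_left_injective₀ (inner_self_ne_zero.mpr hΦ) h3

/-- **Key lemma for (2.29).** For a `C`-eigenvector `Φ` (real eigenvalue `c`), every matrix
element `⟪(O^+)^M Φ, O^+ (O^+)^{M'} Φ⟫` (`M, M' ∈ ℤ`) is real: it vanishes unless
`M = M' + 1` by charge orthogonality, and for `M = M' + 1` it is a squared norm
(`‖(O^+)^{M'+1} Φ‖²` if `M' ≥ 0`, `‖(O^-)^{|M'|} Φ‖²` if `M' < 0`).
[cite: KomaTasaki1994, proof of Theorem 2.5] -/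
theorem im_inner_orderPow_orderPlus_orderPow {Φ : E} {c : ℂ} (hC : sys.C Φ = c • Φ)
    (hc : conj c = c) (M M' : ℤ) :
    (⟪sys.orderPow M Φ, sys.orderPlus (sys.orderPow M' Φ)⟫_ℂ).im = 0 := by
  by_cases hMM' : M = M' + 1
  · subst hMM'
    rcases le_or_gt 0 M' with hM' | hM'
    · have h : sys.orderPlus (sys.orderPow M' Φ) = sys.orderPow (M' + 1) Φ := by
        rw [sys.orderPow_add_one_of_nonneg hM', mul_apply_eq_comp]
      rw [h]
      simpa using inner_self_im (𝕜 := ℂ) (sys.orderPow (M' + 1) Φ)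
    · have h : sys.orderPow M' = sys.orderMinus * sys.orderPow (M' + 1) := by
        have := sys.orderPow_sub_one_of_nonpos (M := M' + 1) (by omega)
        rwa [add_sub_cancel_right] at this
      rw [h, mul_apply_eq_comp, ← sys.inner_orderMinus_left]
      simpa using inner_self_im (𝕜 := ℂ) (sys.orderMinus (sys.orderPow (M' + 1) Φ))
  · have hx := sys.C_orderPow_apply hC M
    have hy : sys.C (sys.orderPlus (sys.orderPow M' Φ)) =
        (c + M' + 1) • sys.orderPlus (sys.orderPow M' Φ) :=
      sys.C_orderPlus_apply (sys.C_orderPow_apply hC M')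
    rw [sys.inner_eq_zero_of_eigen_C hx hy ?_, Complex.zero_im]
    rw [map_add, hc, map_intCast]
    intro h
    apply hMM'
    have h' : (M : ℂ) = M' + 1 := by linear_combination h
    exact_mod_cast h'

omit [Fintype Λ] in
/-- Normalising both vectors does not affect reality of a matrix element. [folklore] -/
theorem im_inner_normalize_apply (T : E →L[ℂ] E) (v w : E) (h : (⟪v, T w⟫_ℂ).im = 0) :
    (⟪(‖v‖⁻¹ : ℂ) • v, T ((‖w‖⁻¹ : ℂ) • w)⟫_ℂ).im = 0 := by
  rw [map_smul, inner_smul_left, inner_smul_right, ← mul_assoc]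
  have hc : (starRingEnd ℂ) (‖v‖⁻¹ : ℂ) * (‖w‖⁻¹ : ℂ) = ((‖v‖⁻¹ * ‖w‖⁻¹ : ℝ) : ℂ) := by
    push_cast
    rw [map_inv₀, Complex.conj_ofReal]
  rw [hc, Complex.im_ofReal_mul, h, mul_zero]

/-- The matrix elements `⟪Ψ^{(M)}, O^+ Ψ^{(M')}⟫` of `O^+` between the trial states (2.19)
are real. [cite: KomaTasaki1994, proof of Theorem 2.5] -/
theorem im_inner_trialState_orderPlus_trialState {Φ : E} {c : ℂ} (hC : sys.C Φ = c • Φ)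
    (hc : conj c = c) (M M' : ℤ) :
    (⟪sys.trialState M Φ, sys.orderPlus (sys.trialState M' Φ)⟫_ℂ).im = 0 :=
  im_inner_normalize_apply _ _ _ (sys.im_inner_orderPow_orderPlus_orderPow hC hc M M')

/-- If `⟪ξ, O^+ ξ⟫` is real then `⟪ξ, O^{(2)} ξ⟫ = 0` (as `O^+ = O^{(1)} + i O^{(2)}` with
`O^{(1)}, O^{(2)}` symmetric). [cite: KomaTasaki1994, proof of Theorem 2.5] -/
theorem inner_order_one_eq_zero_of_im (ξ : E) (him : (⟪ξ, sys.orderPlus ξ⟫_ℂ).im = 0) :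
    ⟪ξ, sys.order 1 ξ⟫_ℂ = 0 := by
  have hO1im : (⟪ξ, sys.order 0 ξ⟫_ℂ).im = 0 := by
    refine Complex.conj_eq_iff_im.mp ?_
    rw [inner_conj_symm]
    exact sys.isSymmetric_order 0 ξ ξ
  have hO2im : (⟪ξ, sys.order 1 ξ⟫_ℂ).im = 0 := by
    refine Complex.conj_eq_iff_im.mp ?_
    rw [inner_conj_symm]
    exact sys.isSymmetric_order 1 ξ ξ
  have hdecomp : ⟪ξ, sys.orderPlus ξ⟫_ℂ = ⟪ξ, sys.order 0 ξ⟫_ℂ + I * ⟪ξ, sys.order 1 ξ⟫_ℂ := by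
    simp only [orderPlus, add_apply, smul_apply,
      inner_add_right, inner_smul_right]
  have hre : (⟪ξ, sys.order 1 ξ⟫_ℂ).re = 0 := by
    have h1 := congrArg Complex.im hdecomp
    rw [him, Complex.add_im, hO1im, Complex.mul_im, Complex.I_re, Complex.I_im, hO2im] at h1
    linarith
  exact Complex.ext (by simpa using hre) (by simpa using hO2im)

end U1System

/-- **KT Theorem 2.5, (2.29) — PROVED.** The named fact `theorem_2_5_orderTwo` holds:
`⟨Ξ^{(k)}, O^{(2)} Ξ^{(k)}⟩ = 0` for the symmetry-breaking trial state (2.27). The proof is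
KT's (charge bookkeeping with (2.16) and reality of the surviving matrix elements); it uses
only that `Φ` is a normalised `C`-eigenvector, not the size conditions (2.20)–(2.21).
[cite: KomaTasaki1994, Theorem 2.5 (2.29)] -/
theorem theorem_2_5_orderTwo_holds : theorem_2_5_orderTwo.{u, v} := by
  intro Λ _ E _ _ _ sys Φ EΛ μ hΦ _hN k _hk _hkN
  obtain ⟨c, hC⟩ := hΦ.eigen_C
  have hΦne : Φ ≠ 0 := by
    intro h0
    have h1 := hΦ.norm_eq_one
    rw [h0, norm_zero] at h1
    exact zero_ne_one h1
  have hc : conj c = c := sys.conj_eq_of_eigen_C hΦne hC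
  have key : ∀ M M' : ℤ,
      (⟪sys.trialState M Φ, sys.orderPlus (sys.trialState M' Φ)⟫_ℂ).im = 0 :=
    fun M M' => sys.im_inner_trialState_orderPlus_trialState hC hc M M'
  have ht0 : sys.trialState 0 Φ = Φ := by
    simp [U1System.trialState, U1System.orderPow, hΦ.norm_eq_one]
  have k1 : ∀ M' : ℤ, (⟪Φ, sys.orderPlus (sys.trialState M' Φ)⟫_ℂ).im = 0 := fun M' => by
    have h := key 0 M'
    rwa [ht0] at h
  have k2 : ∀ M : ℤ, (⟪sys.trialState M Φ, sys.orderPlus Φ⟫_ℂ).im = 0 := fun M => by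
    have h := key M 0
    rwa [ht0] at h
  have k3 : (⟪Φ, sys.orderPlus Φ⟫_ℂ).im = 0 := by
    have h := key 0 0
    rwa [ht0] at h
  -- the unnormalised vector `ξ = Φ + Σ_{M=1}^k (Ψ^{(M)} + Ψ^{(-M)})` has `Im ⟪ξ, O⁺ ξ⟫ = 0`
  have him : (⟪Φ + ∑ M ∈ Finset.Icc 1 k, (sys.trialState M Φ + sys.trialState (-(M : ℤ)) Φ),
      sys.orderPlus (Φ + ∑ M ∈ Finset.Icc 1 k,
        (sys.trialState M Φ + sys.trialState (-(M : ℤ)) Φ))⟫_ℂ).im = 0 := by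
    simp only [map_add, map_sum, inner_add_left, inner_add_right, sum_inner, inner_sum,
      Complex.add_im, Complex.im_sum, key, k1, k2, k3, Finset.sum_const_zero, add_zero]
  have hzero := sys.inner_order_one_eq_zero_of_im _ him
  show ⟪((Real.sqrt (2 * k + 1))⁻¹ : ℂ) • (Φ + ∑ M ∈ Finset.Icc 1 k,
      (sys.trialState M Φ + sys.trialState (-(M : ℤ)) Φ)),
    sys.order 1 (((Real.sqrt (2 * k + 1))⁻¹ : ℂ) • (Φ + ∑ M ∈ Finset.Icc 1 k,
      (sys.trialState M Φ + sys.trialState (-(M : ℤ)) Φ)))⟫_ℂ = 0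
  rw [map_smul, inner_smul_left, inner_smul_right, hzero, mul_zero, mul_zero]

end Literature.MathematicalPhysics.QuantumLattice.KomaTasaki
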